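import Literature.AlgebraicGeometry.HodgeTheory.HodgeIndexOneOneLefschetzForm
import Literature.AlgebraicGeometry.HodgeTheory.AbelianVarietyHodgeNumbers
import HarnessLib

/-!
# Validation instance: the index of `∫_A ω^{g-2} ∧ α ∧ β` on `H²(A(ℂ); ℝ)` for an abelian variety

Family `hodge`, layer `Literature/AlgebraicGeometry/HodgeTheory`; lane `lit-hodgefound` (Track 2
foundations library, Layer A validation "dimension counts"). THEOREMS ONLY (no definition, no named
fact; D-0026). A sanity instance, on the Betti carrier `A(ℂ)` of a complex abelian variety `A` of
dimension `g ≥ 2`, of the `n`-fold Hodge index theorem in degree two of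
`HodgeIndexTheoremLefschetzForms.lean` (Voisin I, §6.3.2 Lemma 6.31 and Thm. 6.32 at `k = 2`:
`b⁺(B₂) = 2 h^{2,0} + 1`, `b⁻(B₂) = h^{1,1} - 1` for the real Lefschetz form
`B₂(y, y') = ⟨L^{g-2}_{re H_η} y ⌣ y', [A(ℂ)]_μ ⊗ 1⟩`, `μ` an orientation pairing positively with the
volume class) and of its restriction to the real `(1,1)`-classes (`HodgeIndexOneOneLefschetzForm.lean`,
index `(1, h^{1,1} - 1)`), read through the Hodge numbers of an abelian variety
`h^{p,q}(A) = C(g, p) C(g, q)` (Birkenhake–Lange / Lange 2023, Thm. 1.1.21; the tree's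
`HodgeModel.finrank_typePiece_eq_choose_mul_choose`): for EVERY Kähler–rational datum `D` on `A`
(`2 + r = g`) and the positive orientation,

* `AbelianVariety.sigPos_sigNeg_lefschetzForm_two_of_pos` — **`b⁺(B₂) = 2 C(g,2) + 1` and
  `b⁻(B₂) + 1 = g²`** (`h^{2,0}(A) = C(g,2)`, `h^{1,1}(A) = g²`);
* `AbelianVariety.sigPos_sigNeg_lefschetzForm_two_of_pos'` — the same as **`b⁺(B₂) = g(g-1) + 1`,
  `b⁻(B₂) = g² - 1`**;
* `AbelianVariety.sigPos_add_sigNeg_lefschetzForm_two` — the check **`b⁺(B₂) + b⁻(B₂) = C(2g, 2) = b₂(A)`**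
  (`b_k(A) = C(2g, k)`, Lange 2023 Cor. 1.1.18; the tree's `AbelianVariety.finrank_bettiCohomology`),
  i.e. `(g(g-1) + 1) + (g² - 1) = g(2g-1)`;
* `AbelianVariety.sigPos_sigNeg_lefschetzForm_restrict_oneOne_of_pos` — on `U = H^{1,1}_ℝ ⊆ H²(A(ℂ); ℝ)`
  the form has index **`(1, g² - 1)`**;
* `AbelianVariety.exists_orientation_sigPos_sigNeg_lefschetzForm_two` — orientation-free packaging
  (the positive orientation exists and every orientation is `±` it).

(The torus-carrier statements for a complex torus on invariant forms are
`Geometry/Kaehler/ComplexTorusHodgeIndexSignature`; here the carrier is the Betti cohomology of the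
algebraic variety with a Kähler–rational datum, and the route is Voisin's Thm. 6.32.)

## References

* [VoisinHodgeI2002] C. Voisin, Hodge Theory and Complex Algebraic Geometry I (CUP 2002), §6.3.2
  Lemma 6.31, Thm. 6.32 (PDF pp. 128–129 of the held text).
* [Lange2023AbelianVarietiesComplex] H. Lange, Abelian Varieties over the Complex Numbers (2023),
  §1.1.3 Cor. 1.1.18, §1.1.5 Thm. 1.1.21 (PDF pp. 25–27).
* [HuybrechtsCG2005] D. Huybrechts, Complex Geometry (2005), Cor. 3.3.16 (the shape `(2h^{2,0}+1, h^{1,1}-1)`,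
  `(1, h^{1,1}-1)`).
-/

noncomputable section

open scoped Manifold ContDiff
open CategoryTheory AlgebraicGeometry Module Bundle Finset
open Literature.AlgebraicTopology.SingularHomology Literature.Geometry.Kaehler
open Literature.NumberTheory.Transcendental
open Literature.AlgebraicGeometry.Motives (AbelianVariety ComplexPoints IsSmoothProjective)
open Finset.HasAntidiagonal (antidiagonal mem_antidiagonal)

namespace Literature.AlgebraicGeometry.HodgeTheory

section AbelianVarietyValidation

/-- `h^{p,q}(A) = C(g, p) C(g, q)` in the `hodgePQ k p q` spelling.
[cite: Lange2023AbelianVarietiesComplex, §1.1.5 Thm. 1.1.21 (PDF p. 25)] -/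
private theorem finrank_hodgePQ_eq_choose_mul_choose' (A : AbelianVariety ℂ)
    (B : HodgeModel A.dim A.X) (k p q : ℕ) (h : p + q = k) :
    Module.finrank ℂ (B.hodgePQ k p q) = A.dim.choose p * A.dim.choose q := by
  rw [← B.finrank_typePiece_eq_finrank_hodgePQ (mem_antidiagonal.2 h),
    HodgeModel.finrank_typePiece_eq_choose_mul_choose A B]

/-- `2 C(g, 2) = g (g - 1)`. [folklore] -/
private theorem two_mul_choose_two' (g : ℕ) : 2 * g.choose 2 = g * (g - 1) := by
  rw [Nat.choose_two_right, mul_comm, Nat.div_two_mul_two_of_even (Nat.even_mul_pred_self g)]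

/-- **The degree-two Hodge index theorem on an abelian variety, in Hodge numbers.** Let `A` be a
complex abelian variety of dimension `g` with `2 + r = g`, `D` a Kähler–rational datum on `A`
(real Kähler class `re H_η`, volume class `y_Ω`), `μ` a `ℤ`-orientation of the closed `2g`-manifold
`A(ℂ)` pairing positively with `y_Ω`, and `B₂(y, y') = ⟨Lʳ_{re H_η} y ⌣ y', [A(ℂ)]_μ ⊗ 1⟩` the real
Lefschetz form on `H²(A(ℂ); ℝ)` (Voisin's `∫_A ω^{g-2} ∧ α ∧ β`). Then `b⁺(B₂) = 2 C(g, 2) + 1` and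
`b⁻(B₂) + 1 = g²`: Thm. 6.32 at `k = 2` gives `(2 h^{2,0} + 1, h^{1,1} - 1)`
(`KaehlerRationalDatum.sigPos_sigNeg_lefschetzForm_two_of_pos`), and `h^{2,0}(A) = C(g,2) C(g,0) = C(g,2)`,
`h^{1,1}(A) = C(g,1)² = g²` (Thm. 1.1.21).
[cite: VoisinHodgeI2002, §6.3.2 Lemma 6.31 and Thm. 6.32] [cite: Lange2023AbelianVarietiesComplex, §1.1.5 Thm. 1.1.21 (PDF p. 25)] -/
theorem AbelianVariety.sigPos_sigNeg_lefschetzForm_two_of_pos (A : AbelianVariety ℂ)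
    (D : KaehlerRationalDatum A.dim A.X) {r m : ℕ} (hr : 2 + r = A.dim) (hm : 2 + 2 * r = m)
    (hdeg : m + 2 = 2 * A.dim) (μ : HomologicalOrientation ℤ (ComplexPoints A.X) (2 * A.dim))
    (hP : 0 < kroneckerPairing ℝ ℝ (ComplexPoints A.X) (2 * A.dim)
      (reClass _ (2 * A.dim) D.topClass)
      (singularHomology.coeffChange (ComplexPoints A.X)
        (algebraMap ℤ ℝ : ℤ →+* ℝ).toAddMonoidHom (2 * A.dim) μ.fundamentalClass)) :
    sigPos (LinearMap.BilinMap.toQuadraticMap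
        (((cupProduct (R := ℝ) (X := ComplexPoints A.X) hdeg).compr₂
          ((kroneckerPairing ℝ ℝ (ComplexPoints A.X) (2 * A.dim)).flip
            (singularHomology.coeffChange (ComplexPoints A.X)
              (algebraMap ℤ ℝ : ℤ →+* ℝ).toAddMonoidHom (2 * A.dim) μ.fundamentalClass))) ∘ₗ
          lefschetzPowTo (reClass (ComplexPoints A.X) 2 D.Hη) r 2 m hm)) =
        2 * A.dim.choose 2 + 1 ∧
      sigNeg (LinearMap.BilinMap.toQuadraticMap
        (((cupProduct (R := ℝ) (X := ComplexPoints A.X) hdeg).compr₂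
          ((kroneckerPairing ℝ ℝ (ComplexPoints A.X) (2 * A.dim)).flip
            (singularHomology.coeffChange (ComplexPoints A.X)
              (algebraMap ℤ ℝ : ℤ →+* ℝ).toAddMonoidHom (2 * A.dim) μ.fundamentalClass))) ∘ₗ
          lefschetzPowTo (reClass (ComplexPoints A.X) 2 D.Hη) r 2 m hm)) + 1 =
        A.dim ^ 2 := by
  have hX : IsSmoothProjective A.dim A.X := Motives.AbelianVariety.isSmoothProjective_holds
  obtain ⟨B⟩ := nonempty_hodgeModel_holds (n := A.dim) (X := A.X) hX
  obtain ⟨h1, h2⟩ := D.sigPos_sigNeg_lefschetzForm_two_of_pos hX B hr hm hdeg μ hP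
  have h20 : Module.finrank ℂ (B.hodgePQ 2 2 0) = A.dim.choose 2 := by
    rw [finrank_hodgePQ_eq_choose_mul_choose' A B 2 2 0 rfl, Nat.choose_zero_right, mul_one]
  have h11 : Module.finrank ℂ (B.hodgePQ 2 1 1) = A.dim ^ 2 := by
    rw [finrank_hodgePQ_eq_choose_mul_choose' A B 2 1 1 rfl, Nat.choose_one_right, sq]
  rw [h20] at h1
  rw [h11] at h2
  exact ⟨h1, h2⟩

/-- **The same count as `b⁺(B₂) = g(g - 1) + 1`, `b⁻(B₂) = g² - 1`** (`2 C(g,2) = g(g-1)`; `g ≥ 2`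
so `g² ≥ 1`). [cite: VoisinHodgeI2002, §6.3.2 Lemma 6.31 and Thm. 6.32]
[cite: Lange2023AbelianVarietiesComplex, §1.1.5 Thm. 1.1.21 (PDF p. 25)] -/
theorem AbelianVariety.sigPos_sigNeg_lefschetzForm_two_of_pos' (A : AbelianVariety ℂ)
    (D : KaehlerRationalDatum A.dim A.X) {r m : ℕ} (hr : 2 + r = A.dim) (hm : 2 + 2 * r = m)
    (hdeg : m + 2 = 2 * A.dim) (μ : HomologicalOrientation ℤ (ComplexPoints A.X) (2 * A.dim))
    (hP : 0 < kroneckerPairing ℝ ℝ (ComplexPoints A.X) (2 * A.dim)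
      (reClass _ (2 * A.dim) D.topClass)
      (singularHomology.coeffChange (ComplexPoints A.X)
        (algebraMap ℤ ℝ : ℤ →+* ℝ).toAddMonoidHom (2 * A.dim) μ.fundamentalClass)) :
    sigPos (LinearMap.BilinMap.toQuadraticMap
        (((cupProduct (R := ℝ) (X := ComplexPoints A.X) hdeg).compr₂
          ((kroneckerPairing ℝ ℝ (ComplexPoints A.X) (2 * A.dim)).flip
            (singularHomology.coeffChange (ComplexPoints A.X)
              (algebraMap ℤ ℝ : ℤ →+* ℝ).toAddMonoidHom (2 * A.dim) μ.fundamentalClass))) ∘ₗ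
          lefschetzPowTo (reClass (ComplexPoints A.X) 2 D.Hη) r 2 m hm)) =
        A.dim * (A.dim - 1) + 1 ∧
      sigNeg (LinearMap.BilinMap.toQuadraticMap
        (((cupProduct (R := ℝ) (X := ComplexPoints A.X) hdeg).compr₂
          ((kroneckerPairing ℝ ℝ (ComplexPoints A.X) (2 * A.dim)).flip
            (singularHomology.coeffChange (ComplexPoints A.X)
              (algebraMap ℤ ℝ : ℤ →+* ℝ).toAddMonoidHom (2 * A.dim) μ.fundamentalClass))) ∘ₗ
          lefschetzPowTo (reClass (ComplexPoints A.X) 2 D.Hη) r 2 m hm)) =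
        A.dim ^ 2 - 1 := by
  obtain ⟨h1, h2⟩ := AbelianVariety.sigPos_sigNeg_lefschetzForm_two_of_pos A D hr hm hdeg μ hP
  refine ⟨by rw [h1, two_mul_choose_two'], ?_⟩
  have hg : 1 ≤ A.dim ^ 2 := Nat.one_le_pow _ _ (by omega)
  omega

/-- **Non-degeneracy check: `b⁺(B₂) + b⁻(B₂) = C(2g, 2) = b₂(A)`** — the index `(g(g-1)+1, g²-1)`
adds up to the second Betti number `b₂(A) = C(2g, 2)` of the abelian variety (`B₂` is
non-degenerate, `KaehlerRationalDatum.sigPos_add_sigNeg_lefschetzForm_eq_finrank`; `b_k(A) = C(2g,k)`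
is field-independent by universal coefficients).
[cite: VoisinHodgeI2002, §6.3.2 Lemma 6.31 and Thm. 6.32]
[cite: Lange2023AbelianVarietiesComplex, §1.1.3 Cor. 1.1.18 (PDF p. 27)] -/
theorem AbelianVariety.sigPos_add_sigNeg_lefschetzForm_two (A : AbelianVariety ℂ)
    (D : KaehlerRationalDatum A.dim A.X) {r m : ℕ} (hr : 2 + r = A.dim) (hm : 2 + 2 * r = m)
    (hdeg : m + 2 = 2 * A.dim) (μ : HomologicalOrientation ℤ (ComplexPoints A.X) (2 * A.dim))
    (hP : 0 < kroneckerPairing ℝ ℝ (ComplexPoints A.X) (2 * A.dim)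
      (reClass _ (2 * A.dim) D.topClass)
      (singularHomology.coeffChange (ComplexPoints A.X)
        (algebraMap ℤ ℝ : ℤ →+* ℝ).toAddMonoidHom (2 * A.dim) μ.fundamentalClass)) :
    sigPos (LinearMap.BilinMap.toQuadraticMap
        (((cupProduct (R := ℝ) (X := ComplexPoints A.X) hdeg).compr₂
          ((kroneckerPairing ℝ ℝ (ComplexPoints A.X) (2 * A.dim)).flip
            (singularHomology.coeffChange (ComplexPoints A.X)
              (algebraMap ℤ ℝ : ℤ →+* ℝ).toAddMonoidHom (2 * A.dim) μ.fundamentalClass))) ∘ₗ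
          lefschetzPowTo (reClass (ComplexPoints A.X) 2 D.Hη) r 2 m hm)) +
      sigNeg (LinearMap.BilinMap.toQuadraticMap
        (((cupProduct (R := ℝ) (X := ComplexPoints A.X) hdeg).compr₂
          ((kroneckerPairing ℝ ℝ (ComplexPoints A.X) (2 * A.dim)).flip
            (singularHomology.coeffChange (ComplexPoints A.X)
              (algebraMap ℤ ℝ : ℤ →+* ℝ).toAddMonoidHom (2 * A.dim) μ.fundamentalClass))) ∘ₗ
          lefschetzPowTo (reClass (ComplexPoints A.X) 2 D.Hη) r 2 m hm)) =
        (2 * A.dim).choose 2 := by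
  have hX : IsSmoothProjective A.dim A.X := Motives.AbelianVariety.isSmoothProjective_holds
  rw [D.sigPos_add_sigNeg_lefschetzForm_eq_finrank hX (k := 2) ⟨1, rfl⟩ hr hm hdeg μ hP,
    ← AbelianVariety.finrank_bettiCohomology A 2]
  change Module.finrank ℝ (singularCohomology ℝ ℝ (ComplexPoints A.X) 2) =
    Module.finrank ℚ (singularCohomology ℚ ℚ (ComplexPoints A.X) 2)
  rw [finrank_singularCohomology_eq_bettiNumber_of_field ℝ (ComplexPoints A.X) 2,
    finrank_singularCohomology_eq_bettiNumber_of_field ℚ (ComplexPoints A.X) 2,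
    bettiNumber_eq_of_algebra ℚ ℝ]

/-- **The Hodge index theorem on the real `(1,1)`-classes of an abelian variety: index `(1, g² - 1)`.**
For `A`, `D`, `2 + r = g`, `μ` positive as above and a real subspace `U ⊆ H²(A(ℂ); ℝ)` consisting
exactly of the classes whose complexification is of type `(1,1)`, the restriction of `B₂` to `U` has
`b⁺ = 1` and `b⁻ + 1 = g² = h^{1,1}(A) = dim_ℝ U`
(`KaehlerRationalDatum.sigPos_sigNeg_lefschetzForm_restrict_oneOne_eq_hodgeNumber` and Thm. 1.1.21).
[cite: VoisinHodgeI2002, §6.3.2 Thm. 6.32] [cite: Hartshorne1977, Ch. V Thm. 1.9 and Rem. 1.9.1]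
[cite: Lange2023AbelianVarietiesComplex, §1.1.5 Thm. 1.1.21 (PDF p. 25)] -/
theorem AbelianVariety.sigPos_sigNeg_lefschetzForm_restrict_oneOne_of_pos (A : AbelianVariety ℂ)
    (D : KaehlerRationalDatum A.dim A.X) {r m : ℕ} (hr : 2 + r = A.dim) (hm : 2 + 2 * r = m)
    (hdeg : m + 2 = 2 * A.dim) (μ : HomologicalOrientation ℤ (ComplexPoints A.X) (2 * A.dim))
    (hP : 0 < kroneckerPairing ℝ ℝ (ComplexPoints A.X) (2 * A.dim)
      (reClass _ (2 * A.dim) D.topClass)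
      (singularHomology.coeffChange (ComplexPoints A.X)
        (algebraMap ℤ ℝ : ℤ →+* ℝ).toAddMonoidHom (2 * A.dim) μ.fundamentalClass))
    (U : Submodule ℝ (singularCohomology ℝ ℝ (ComplexPoints A.X) 2))
    (hU : ∀ y, y ∈ U ↔ IsOfHodgeType A.dim A.X 2 1 1 (ofRealClass _ 2 y)) :
    sigPos ((LinearMap.BilinMap.toQuadraticMap
        (((cupProduct (R := ℝ) (X := ComplexPoints A.X) hdeg).compr₂
          ((kroneckerPairing ℝ ℝ (ComplexPoints A.X) (2 * A.dim)).flip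
            (singularHomology.coeffChange (ComplexPoints A.X)
              (algebraMap ℤ ℝ : ℤ →+* ℝ).toAddMonoidHom (2 * A.dim) μ.fundamentalClass))) ∘ₗ
          lefschetzPowTo (reClass (ComplexPoints A.X) 2 D.Hη) r 2 m hm)).restrict U) = 1 ∧
      sigNeg ((LinearMap.BilinMap.toQuadraticMap
        (((cupProduct (R := ℝ) (X := ComplexPoints A.X) hdeg).compr₂
          ((kroneckerPairing ℝ ℝ (ComplexPoints A.X) (2 * A.dim)).flip
            (singularHomology.coeffChange (ComplexPoints A.X)
              (algebraMap ℤ ℝ : ℤ →+* ℝ).toAddMonoidHom (2 * A.dim) μ.fundamentalClass))) ∘ₗ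
          lefschetzPowTo (reClass (ComplexPoints A.X) 2 D.Hη) r 2 m hm)).restrict U) + 1 =
        A.dim ^ 2 := by
  have hX : IsSmoothProjective A.dim A.X := Motives.AbelianVariety.isSmoothProjective_holds
  obtain ⟨B⟩ := nonempty_hodgeModel_holds (n := A.dim) (X := A.X) hX
  have h := D.sigPos_sigNeg_lefschetzForm_restrict_oneOne_eq_hodgeNumber hX hr hm hdeg μ hP U hU B
  have h11 : Module.finrank ℂ (B.typePiece 2 ⟨(1, 1), mem_antidiagonal.2 rfl⟩) = A.dim ^ 2 := by
    rw [HodgeModel.finrank_typePiece_eq_choose_mul_choose A B]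
    exact (by rw [Nat.choose_one_right, sq] : A.dim.choose 1 * A.dim.choose 1 = A.dim ^ 2)
  rw [h11] at h
  exact h

/-- **`dim_ℝ H^{1,1}_ℝ(A) = g²`** for a real subspace `U ⊆ H²(A(ℂ); ℝ)` consisting exactly of the
classes of type `(1,1)` (`finrank_real_eq_hodgeNumber_self` and `h^{1,1}(A) = g²`).
[cite: VoisinHodgeI2002, §6.1.3 Cor. 6.12–6.13] [cite: Lange2023AbelianVarietiesComplex, §1.1.5 Thm. 1.1.21 (PDF p. 25)] -/
theorem AbelianVariety.finrank_realOneOne_eq_sq (A : AbelianVariety ℂ)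
    (U : Submodule ℝ (singularCohomology ℝ ℝ (ComplexPoints A.X) 2))
    (hU : ∀ y, y ∈ U ↔ IsOfHodgeType A.dim A.X 2 1 1 (ofRealClass _ 2 y)) :
    Module.finrank ℝ U = A.dim ^ 2 := by
  have hX : IsSmoothProjective A.dim A.X := Motives.AbelianVariety.isSmoothProjective_holds
  obtain ⟨B⟩ := nonempty_hodgeModel_holds (n := A.dim) (X := A.X) hX
  rw [finrank_real_eq_hodgeNumber_self hX (k := 2) (p := 1) (mem_antidiagonal.2 rfl) U hU B,
    HodgeModel.finrank_typePiece_eq_choose_mul_choose A B]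
  exact (by rw [Nat.choose_one_right, sq] : A.dim.choose 1 * A.dim.choose 1 = A.dim ^ 2)

/-- **Orientation-free packaging.** For a complex abelian variety `A` of dimension `g = 2 + r` and a
Kähler–rational datum `D` there is a `ℤ`-orientation `μ` of `A(ℂ)` — every orientation is `±μ` —
for which the real Lefschetz form `B₂ = ⟨Lʳ_{re H_η} y ⌣ y', [A(ℂ)]_μ ⊗ 1⟩` on `H²(A(ℂ); ℝ)` has
`b⁺ = g(g-1) + 1`, `b⁻ = g² - 1`, and index `(1, g² - 1)` on every real `(1,1)`-subspace `U`
(`U = H^{1,1}_ℝ`). [cite: VoisinHodgeI2002, §6.3.2 Lemma 6.31 and Thm. 6.32]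
[cite: Lange2023AbelianVarietiesComplex, §1.1.5 Thm. 1.1.21 (PDF p. 25)] -/
theorem AbelianVariety.exists_orientation_sigPos_sigNeg_lefschetzForm_two (A : AbelianVariety ℂ)
    (D : KaehlerRationalDatum A.dim A.X) {r m : ℕ} (hr : 2 + r = A.dim) (hm : 2 + 2 * r = m)
    (hdeg : m + 2 = 2 * A.dim) :
    ∃ μ : HomologicalOrientation ℤ (ComplexPoints A.X) (2 * A.dim),
      (∀ ν : HomologicalOrientation ℤ (ComplexPoints A.X) (2 * A.dim), ν = μ ∨ ν = -μ) ∧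
      sigPos (LinearMap.BilinMap.toQuadraticMap
          (((cupProduct (R := ℝ) (X := ComplexPoints A.X) hdeg).compr₂
            ((kroneckerPairing ℝ ℝ (ComplexPoints A.X) (2 * A.dim)).flip
              (singularHomology.coeffChange (ComplexPoints A.X)
                (algebraMap ℤ ℝ : ℤ →+* ℝ).toAddMonoidHom (2 * A.dim) μ.fundamentalClass))) ∘ₗ
            lefschetzPowTo (reClass (ComplexPoints A.X) 2 D.Hη) r 2 m hm)) =
          A.dim * (A.dim - 1) + 1 ∧
      sigNeg (LinearMap.BilinMap.toQuadraticMap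
          (((cupProduct (R := ℝ) (X := ComplexPoints A.X) hdeg).compr₂
            ((kroneckerPairing ℝ ℝ (ComplexPoints A.X) (2 * A.dim)).flip
              (singularHomology.coeffChange (ComplexPoints A.X)
                (algebraMap ℤ ℝ : ℤ →+* ℝ).toAddMonoidHom (2 * A.dim) μ.fundamentalClass))) ∘ₗ
            lefschetzPowTo (reClass (ComplexPoints A.X) 2 D.Hη) r 2 m hm)) =
          A.dim ^ 2 - 1 ∧
      ∀ U : Submodule ℝ (singularCohomology ℝ ℝ (ComplexPoints A.X) 2),
        (∀ y, y ∈ U ↔ IsOfHodgeType A.dim A.X 2 1 1 (ofRealClass _ 2 y)) →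
        sigPos ((LinearMap.BilinMap.toQuadraticMap
            (((cupProduct (R := ℝ) (X := ComplexPoints A.X) hdeg).compr₂
              ((kroneckerPairing ℝ ℝ (ComplexPoints A.X) (2 * A.dim)).flip
                (singularHomology.coeffChange (ComplexPoints A.X)
                  (algebraMap ℤ ℝ : ℤ →+* ℝ).toAddMonoidHom (2 * A.dim) μ.fundamentalClass))) ∘ₗ
              lefschetzPowTo (reClass (ComplexPoints A.X) 2 D.Hη) r 2 m hm)).restrict U) = 1 ∧
        sigNeg ((LinearMap.BilinMap.toQuadraticMap
            (((cupProduct (R := ℝ) (X := ComplexPoints A.X) hdeg).compr₂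
              ((kroneckerPairing ℝ ℝ (ComplexPoints A.X) (2 * A.dim)).flip
                (singularHomology.coeffChange (ComplexPoints A.X)
                  (algebraMap ℤ ℝ : ℤ →+* ℝ).toAddMonoidHom (2 * A.dim) μ.fundamentalClass))) ∘ₗ
              lefschetzPowTo (reClass (ComplexPoints A.X) 2 D.Hη) r 2 m hm)).restrict U) =
          A.dim ^ 2 - 1 := by
  have hX : IsSmoothProjective A.dim A.X := Motives.AbelianVariety.isSmoothProjective_holds
  obtain ⟨μ, hall, hP⟩ := D.exists_orientation_kroneckerPairing_reClass_topClass_pos_of_dim hX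
  obtain ⟨h1, h2⟩ := AbelianVariety.sigPos_sigNeg_lefschetzForm_two_of_pos' A D hr hm hdeg μ hP
  refine ⟨μ, hall, h1, h2, fun U hU ↦ ?_⟩
  obtain ⟨h3, h4⟩ :=
    AbelianVariety.sigPos_sigNeg_lefschetzForm_restrict_oneOne_of_pos A D hr hm hdeg μ hP U hU
  exact ⟨h3, by omega⟩

end AbelianVarietyValidation

end Literature.AlgebraicGeometry.HodgeTheory

end
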